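import Literature.NumberTheory.LFunctions.PowerOscillatoryIntegrals
import HarnessLib

/-!
# Granville–Soundararajan 2003, Lemma 7.1, I: the twisted integer sum `∑_{m ≤ z} m^{iα}`

First file of the proof of Lemma 7.1 of Granville–Soundararajan, *Decay of mean values of
multiplicative functions* (the named fact
`Literature.NumberTheory.LFunctions.GranvilleSoundararajan.GranvilleSoundararajan2003_lemma71`).
The printed proof (arXiv math/9911246, p. 9, display after (7.3)) uses
"by partial summation it is easy to see that `∑_{n ≤ z} n^{iα} = z^{1+iα}/(1+iα) + O(1+α²)`".
We prove this here, for an exponent `s` with `Re s = 0`, by the midpoint rule: on each unit interval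
`[m - 1/2, m + 1/2]` the second-order Taylor estimate gives
`|∫ t^s dt - m^s| ≤ |s||s-1|/m²` (`norm_integral_cpow_sub_le`), the integrals add up to
`((N+1/2)^{s+1} - (1/2)^{s+1})/(s+1)` (`N = ⌊z⌋`), and `|(N+1/2)^{s+1} - z^{s+1}| ≤ |s+1|/2`.

Main result: `norm_twistSum_sub_le` —
`‖∑_{m ≤ z} m^{s} - z^{s+1}/(s+1)‖ ≤ 2|s||s-1| + 1` for real `z ≥ 1`, `Re s = 0`;
and the trivial bound `norm_twistSum_le` (`≤ z`).

## References
- [GranvilleSoundararajan2003] A. Granville, K. Soundararajan, *Decay of mean values of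
  multiplicative functions*, Canad. J. Math. 55 (2003), §7, proof of Lemma 7.1 (arXiv p. 9).
-/

noncomputable section

open Finset Real Complex MeasureTheory intervalIntegral Set

namespace Literature.NumberTheory.LFunctions

namespace GranvilleSoundararajan

namespace L71

/-! ### Calculus of `t ↦ t^w` along the positive real axis -/

/-! The derivative of `t ↦ t^w` along the positive real axis (`w t^{w-1}`) is the tree's
`Literature.NumberTheory.LFunctions.AFE.hasDerivAt_ofReal_cpow` (`PowerOscillatoryIntegrals.lean`). -/

/-- `‖t^w‖ = t^{Re w}` packaged for `t ≥ a > 0` and `Re w ≤ 0`: `‖t^w‖ ≤ a^{Re w}`. [folklore] -/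
theorem norm_cpow_le_of_le {a t : ℝ} (ha : 0 < a) (hat : a ≤ t) {w : ℂ} (hw : w.re ≤ 0) :
    ‖(t : ℂ) ^ w‖ ≤ a ^ w.re := by
  rw [Complex.norm_cpow_eq_rpow_re_of_pos (ha.trans_le hat)]
  exact Real.rpow_le_rpow_of_nonpos ha hat hw

/-- **Mean value bound for `t^w` on `[a, b]`, `a > 0`, `Re w ≤ 1`**:
`‖t₁^w - t₂^w‖ ≤ ‖w‖ a^{Re w - 1} |t₁ - t₂|`. [folklore] -/
theorem norm_cpow_sub_cpow_le {a b : ℝ} (ha : 0 < a) {w : ℂ} (hw : w.re ≤ 1) {t₁ t₂ : ℝ}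
    (h₁ : t₁ ∈ Icc a b) (h₂ : t₂ ∈ Icc a b) :
    ‖(t₁ : ℂ) ^ w - (t₂ : ℂ) ^ w‖ ≤ ‖w‖ * a ^ (w.re - 1) * |t₁ - t₂| := by
  have key := Convex.norm_image_sub_le_of_norm_hasDerivWithin_le
    (f := fun v : ℝ => (v : ℂ) ^ w) (f' := fun v : ℝ => w * (v : ℂ) ^ (w - 1)) (s := Icc a b)
    (C := ‖w‖ * a ^ (w.re - 1)) (x := t₂) (y := t₁) ?_ ?_ (convex_Icc a b) h₂ h₁
  · simpa [Real.norm_eq_abs] using key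
  · intro x hx
    exact (AFE.hasDerivAt_ofReal_cpow (ha.trans_le hx.1) w).hasDerivWithinAt
  · intro x hx
    rw [norm_mul]
    refine mul_le_mul_of_nonneg_left ?_ (norm_nonneg _)
    have := norm_cpow_le_of_le ha hx.1 (w := w - 1) (by simp; linarith)
    simpa using this

/-! ### The midpoint rule on one unit interval -/

/-- `∫_{m-1/2}^{m+1/2} (t - m) dt = 0`. [folklore] -/
theorem integral_sub_mid (m : ℝ) : ∫ t in (m - 1 / 2)..(m + 1 / 2), (t - m) = 0 := by
  rw [intervalIntegral.integral_sub intervalIntegrable_id (intervalIntegrable_const), integral_id,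
    intervalIntegral.integral_const, smul_eq_mul]
  ring

/-- **Midpoint rule for `t^s`** (`Re s = 0`, `m ≥ 1`):
`‖∫_{m-1/2}^{m+1/2} t^s dt - m^s‖ ≤ ‖s‖ ‖s - 1‖ / m²`. [folklore] -/
theorem norm_integral_cpow_sub_le {s : ℂ} (hs : s.re = 0) {m : ℝ} (hm : 1 ≤ m) :
    ‖(∫ t in (m - 1 / 2)..(m + 1 / 2), (t : ℂ) ^ s) - (m : ℂ) ^ s‖ ≤ ‖s‖ * ‖s - 1‖ / m ^ 2 := by
  set a : ℝ := m - 1 / 2 with ha_def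
  set b : ℝ := m + 1 / 2 with hb_def
  have ha : 0 < a := by rw [ha_def]; linarith
  have hab : a ≤ b := by rw [ha_def, hb_def]; linarith
  have hmI : m ∈ Icc a b := ⟨by rw [ha_def]; linarith, by rw [hb_def]; linarith⟩
  -- the linearised function `ψ(t) = t^s - s m^{s-1} (t - m)`
  set c : ℂ := s * (m : ℂ) ^ (s - 1) with hc
  set ψ : ℝ → ℂ := fun t => (t : ℂ) ^ s - c * ((t : ℂ) - m) with hψ
  -- Lipschitz bound for `ψ` on `[a, b]`: `‖ψ'‖ ≤ L`
  set L : ℝ := ‖s‖ * (‖s - 1‖ * a ^ ((s - 1).re - 1) * (1 / 2)) with hL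
  have hL0 : 0 ≤ L := by positivity
  have hderiv : ∀ t ∈ Icc a b, HasDerivWithinAt ψ (s * (t : ℂ) ^ (s - 1) - c) (Icc a b) t := by
    intro t ht
    have h1 := AFE.hasDerivAt_ofReal_cpow (ha.trans_le ht.1) s
    have h2 : HasDerivAt (fun v : ℝ => c * ((v : ℂ) - m)) c t := by
      have h3 : HasDerivAt (fun v : ℝ => ((v : ℂ) - m)) 1 t := by
        simpa using (Complex.ofRealCLM.hasDerivAt (x := t)).sub_const (m : ℂ)
      simpa using h3.const_mul c
    exact (h1.sub h2).hasDerivWithinAt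
  have hbound : ∀ t ∈ Icc a b, ‖s * (t : ℂ) ^ (s - 1) - c‖ ≤ L := by
    intro t ht
    rw [hc, ← mul_sub, norm_mul, hL]
    refine mul_le_mul_of_nonneg_left ?_ (norm_nonneg _)
    have h := norm_cpow_sub_cpow_le ha (w := s - 1) (by simp [hs]) ht hmI
    refine h.trans (mul_le_mul_of_nonneg_left ?_ (by positivity))
    rw [abs_le]; constructor <;> [linarith [ht.1, ht.2, hmI.1, hmI.2]; linarith [ht.1, ht.2, hmI.1, hmI.2]]
  have hlip : ∀ t ∈ Icc a b, ‖ψ t - ψ m‖ ≤ L * (1 / 2) := by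
    intro t ht
    have key := Convex.norm_image_sub_le_of_norm_hasDerivWithin_le hderiv hbound (convex_Icc a b) hmI ht
    refine key.trans (mul_le_mul_of_nonneg_left ?_ hL0)
    rw [Real.norm_eq_abs, abs_le]; constructor <;> linarith [ht.1, ht.2]
  -- integrate
  have hψm : ψ m = (m : ℂ) ^ s := by simp [hψ]
  have hint_cpow : IntervalIntegrable (fun t : ℝ => (t : ℂ) ^ s) volume a b :=
    intervalIntegrable_cpow (Or.inl (by rw [hs]))
  have hint_lin : IntervalIntegrable (fun t : ℝ => c * ((t : ℂ) - m)) volume a b :=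
    (continuous_const.mul (Complex.continuous_ofReal.sub continuous_const)).intervalIntegrable _ _
  have hψint : (∫ t in a..b, ψ t) = ∫ t in a..b, (t : ℂ) ^ s := by
    have e1 : (∫ t in a..b, ψ t) = (∫ t in a..b, (t : ℂ) ^ s) - ∫ t in a..b, c * ((t : ℂ) - m) :=
      intervalIntegral.integral_sub hint_cpow hint_lin
    have e2 : (∫ t in a..b, c * ((t : ℂ) - m)) = 0 := by
      rw [intervalIntegral.integral_const_mul]
      have e3 : (∫ t in a..b, ((t : ℂ) - m)) = ((∫ t in a..b, (t - m) : ℝ) : ℂ) := by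
        rw [← intervalIntegral.integral_ofReal]; simp only [Complex.ofReal_sub]
      rw [e3, ha_def, hb_def, integral_sub_mid m]
      simp
    rw [e1, e2, sub_zero]
  have hconst : (∫ _ in a..b, ψ m) = ψ m := by
    rw [intervalIntegral.integral_const, show b - a = 1 by rw [ha_def, hb_def]; ring, one_smul]
  have hψi : IntervalIntegrable ψ volume a b := hint_cpow.sub hint_lin
  have hdiff : (∫ t in a..b, (t : ℂ) ^ s) - (m : ℂ) ^ s = ∫ t in a..b, (ψ t - ψ m) := by
    rw [intervalIntegral.integral_sub hψi intervalIntegrable_const, hψint, hconst, hψm]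
  rw [hdiff]
  have hI : ‖∫ t in a..b, (ψ t - ψ m)‖ ≤ L * (1 / 2) * |b - a| := by
    refine intervalIntegral.norm_integral_le_of_norm_le_const fun t ht => ?_
    rw [Set.uIoc_of_le hab] at ht
    exact hlip t ⟨ht.1.le, ht.2⟩
  rw [show b - a = 1 by rw [ha_def, hb_def]; ring, abs_one, mul_one] at hI
  refine hI.trans ?_
  -- `L/2 = ‖s‖‖s-1‖ a^{-2}/4 ≤ ‖s‖‖s-1‖/m²` since `a ≥ m/2`
  have hre : (s - 1).re - 1 = -2 := by simp [hs]; norm_num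
  rw [hL, hre]
  have hm0 : 0 < m := by linarith
  have ha2 : a ^ (-2 : ℝ) ≤ 4 / m ^ 2 := by
    rw [Real.rpow_neg ha.le, show (2 : ℝ) = (2 : ℕ) by norm_num, Real.rpow_natCast,
      inv_eq_one_div, div_le_div_iff₀ (by positivity) (by positivity)]
    rw [ha_def]; nlinarith
  have hss : 0 ≤ ‖s‖ * ‖s - 1‖ := by positivity
  calc ‖s‖ * (‖s - 1‖ * a ^ (-2 : ℝ) * (1 / 2)) * (1 / 2) = ‖s‖ * ‖s - 1‖ * a ^ (-2 : ℝ) / 4 := by ring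
    _ ≤ ‖s‖ * ‖s - 1‖ * (4 / m ^ 2) / 4 := by gcongr
    _ = ‖s‖ * ‖s - 1‖ / m ^ 2 := by field_simp


/-! ### The twisted integer sum `E(z) = ∑_{m ≤ z} m^s` -/

/-! Notation of the docstrings: `E_s(z) = ∑_{1 ≤ m ≤ z} m^{s}` (GS03 §7: `∑_{n ≤ z} n^{iα}`), always
written out as `∑ m ∈ Finset.Icc 1 ⌊z⌋₊, (m : ℂ) ^ s` (this proof file introduces no definitions). -/

/-- `‖m^s‖ = 1` for `m ≥ 1`, `Re s = 0`. [folklore] -/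
theorem norm_natCast_cpow_eq_one {s : ℂ} (hs : s.re = 0) {m : ℕ} (hm : 1 ≤ m) : ‖(m : ℂ) ^ s‖ = 1 := by
  rw [Complex.norm_natCast_cpow_of_pos (by omega), hs, Real.rpow_zero]

/-- Trivial bound `‖E_s(z)‖ ≤ z` (`z ≥ 0`, `Re s = 0`). [folklore] -/
theorem norm_twistSum_le {s : ℂ} (hs : s.re = 0) {z : ℝ} (hz : 0 ≤ z) :
    ‖∑ m ∈ Finset.Icc 1 ⌊z⌋₊, (m : ℂ) ^ s‖ ≤ z := by
  refine (norm_sum_le _ _).trans ?_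
  calc ∑ m ∈ Finset.Icc 1 ⌊z⌋₊, ‖(m : ℂ) ^ s‖ = ∑ m ∈ Finset.Icc 1 ⌊z⌋₊, (1 : ℝ) :=
        Finset.sum_congr rfl fun m hm => norm_natCast_cpow_eq_one hs (Finset.mem_Icc.mp hm).1
    _ = ⌊z⌋₊ := by simp
    _ ≤ z := Nat.floor_le hz

/-- The unit-interval integrals add up: `∑_{m=1}^{N} ∫_{m-1/2}^{m+1/2} t^s dt = ∫_{1/2}^{N+1/2} t^s dt`.
[folklore] -/
theorem sum_integral_cpow_eq {s : ℂ} (hs : s.re = 0) (N : ℕ) :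
    ∑ m ∈ Finset.Icc 1 N, (∫ t in ((m : ℝ) - 1 / 2)..((m : ℝ) + 1 / 2), (t : ℂ) ^ s)
      = ∫ t in (1 / 2 : ℝ)..((N : ℝ) + 1 / 2), (t : ℂ) ^ s := by
  have hint : ∀ u v : ℝ, IntervalIntegrable (fun t : ℝ => (t : ℂ) ^ s) volume u v :=
    fun u v => intervalIntegrable_cpow (Or.inl (by rw [hs]))
  induction N with
  | zero => simp
  | succ N ih =>
    rw [Finset.sum_Icc_succ_top (by omega), ih, Nat.cast_succ,
      show (N : ℝ) + 1 - 1 / 2 = N + 1 / 2 by ring]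
    exact intervalIntegral.integral_add_adjacent_intervals (hint _ _) (hint _ _)

/-- `‖s + 1‖ ≥ 1` for `Re s = 0`. [folklore] -/
theorem one_le_norm_add_one {s : ℂ} (hs : s.re = 0) : 1 ≤ ‖s + 1‖ := by
  have h := Complex.re_le_norm (s + 1)
  simp [hs] at h
  exact h

/-- **`∑_{m ≤ z} m^{s} = z^{s+1}/(s+1) + O(1 + |s|²)`** (GS03, proof of Lemma 7.1: "by partial summation it
is easy to see that `∑_{n ≤ z} n^{iα} = z^{1+iα}/(1+iα) + O(1+α²)`"), in the explicit form
`‖E_s(z) - z^{s+1}/(s+1)‖ ≤ 2‖s‖‖s-1‖ + 1` for `z ≥ 1`, `Re s = 0`.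
[cite: GranvilleSoundararajan2003, §7, display after (7.3)] -/
theorem norm_twistSum_sub_le {s : ℂ} (hs : s.re = 0) {z : ℝ} (hz : 1 ≤ z) :
    ‖∑ m ∈ Finset.Icc 1 ⌊z⌋₊, (m : ℂ) ^ s - (z : ℂ) ^ (s + 1) / (s + 1)‖ ≤ 2 * ‖s‖ * ‖s - 1‖ + 1 := by
  set N := ⌊z⌋₊ with hN
  have hN1 : 1 ≤ N := Nat.le_floor (by simpa using hz)
  have hzN : (N : ℝ) ≤ z := Nat.floor_le (by linarith)
  have hzN1 : z < N + 1 := Nat.lt_floor_add_one z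
  have hs1 : s + 1 ≠ 0 := fun h => by
    have h1 := one_le_norm_add_one hs
    rw [h, norm_zero] at h1
    exact absurd h1 (by norm_num)
  have hn1 := one_le_norm_add_one hs
  have hn0 : 0 < ‖s + 1‖ := by linarith
  -- the three pieces
  set I : ℕ → ℂ := fun m => ∫ t in ((m : ℝ) - 1 / 2)..((m : ℝ) + 1 / 2), (t : ℂ) ^ s with hI
  have hA : ‖∑ m ∈ Finset.Icc 1 N, (I m - (m : ℂ) ^ s)‖ ≤ 2 * ‖s‖ * ‖s - 1‖ := by
    refine (norm_sum_le _ _).trans ?_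
    have h1 : ∀ m ∈ Finset.Icc 1 N, ‖I m - (m : ℂ) ^ s‖ ≤ ‖s‖ * ‖s - 1‖ * ((m : ℝ) ^ 2)⁻¹ := by
      intro m hm
      have hm1 : (1 : ℝ) ≤ m := by exact_mod_cast (Finset.mem_Icc.mp hm).1
      have := norm_integral_cpow_sub_le hs hm1
      rw [div_eq_mul_inv] at this
      exact this
    refine (Finset.sum_le_sum h1).trans ?_
    rw [← Finset.mul_sum]
    have h2 : ∑ m ∈ Finset.Icc 1 N, ((m : ℝ) ^ 2)⁻¹ ≤ 2 := by
      have e : Finset.Icc 1 N = Finset.Ioo 0 (N + 1) := by ext m; simp; omega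
      rw [e]
      have := sum_Ioo_inv_sq_le (α := ℝ) 0 (N + 1)
      norm_num at this
      exact this
    calc ‖s‖ * ‖s - 1‖ * ∑ m ∈ Finset.Icc 1 N, ((m : ℝ) ^ 2)⁻¹ ≤ ‖s‖ * ‖s - 1‖ * 2 := by gcongr
      _ = 2 * ‖s‖ * ‖s - 1‖ := by ring
  have hB : ‖(((N : ℝ) + 1 / 2 : ℝ) : ℂ) ^ (s + 1) - (z : ℂ) ^ (s + 1)‖ ≤ ‖s + 1‖ * (1 / 2) := by
    have hN1' : (1 : ℝ) ≤ N := by exact_mod_cast hN1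
    have h := norm_cpow_sub_cpow_le (a := 1) (b := N + 1) one_pos (w := s + 1) (by simp [hs])
      (t₁ := (N : ℝ) + 1 / 2) (t₂ := z) ⟨by linarith, by linarith⟩ ⟨hz, hzN1.le⟩
    refine h.trans ?_
    rw [show (s + 1).re - 1 = 0 by simp [hs], Real.rpow_zero, mul_one]
    refine mul_le_mul_of_nonneg_left ?_ (norm_nonneg _)
    rw [abs_le]; constructor <;> linarith
  have hC : ‖(((1 / 2 : ℝ)) : ℂ) ^ (s + 1)‖ = 1 / 2 := by
    rw [Complex.norm_cpow_eq_rpow_re_of_pos (by norm_num)]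
    simp [hs]
  -- assemble
  have hmain : ∑ m ∈ Finset.Icc 1 N, (m : ℂ) ^ s - (z : ℂ) ^ (s + 1) / (s + 1)
      = -(∑ m ∈ Finset.Icc 1 N, (I m - (m : ℂ) ^ s))
        + ((((N : ℝ) + 1 / 2 : ℝ) : ℂ) ^ (s + 1) - (z : ℂ) ^ (s + 1)) / (s + 1)
        - (((1 / 2 : ℝ)) : ℂ) ^ (s + 1) / (s + 1) := by
    have hsum : ∑ m ∈ Finset.Icc 1 N, I m = ∫ t in (1 / 2 : ℝ)..((N : ℝ) + 1 / 2), (t : ℂ) ^ s :=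
      sum_integral_cpow_eq hs N
    have hev : (∫ t in (1 / 2 : ℝ)..((N : ℝ) + 1 / 2), (t : ℂ) ^ s)
        = ((((N : ℝ) + 1 / 2 : ℝ) : ℂ) ^ (s + 1) - (((1 / 2 : ℝ)) : ℂ) ^ (s + 1)) / (s + 1) :=
      integral_cpow (Or.inl (by rw [hs]; norm_num))
    rw [Finset.sum_sub_distrib, hsum, hev]
    field_simp
    ring
  rw [hmain]
  refine (norm_sub_le _ _).trans ?_
  refine (add_le_add (norm_add_le _ _) le_rfl).trans ?_
  rw [norm_neg, norm_div, norm_div, hC]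
  have hB' : ‖(((N : ℝ) + 1 / 2 : ℝ) : ℂ) ^ (s + 1) - (z : ℂ) ^ (s + 1)‖ / ‖s + 1‖ ≤ 1 / 2 := by
    rw [div_le_iff₀ hn0]; linarith
  have hC' : 1 / 2 / ‖s + 1‖ ≤ 1 / 2 := div_le_self (by norm_num) hn1
  linarith

end L71

end GranvilleSoundararajan

end Literature.NumberTheory.LFunctions
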